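import Summits.RiemannHypothesis.RiemannHypothesis.Theorems.GroundBartaGroundBartaFloorLeakageEnvelope
import Summits.RiemannHypothesis.RiemannHypothesis.Theorems.WeilGroundStateGroundStatesConvergeToXiExpClassHarmonic
import Summits.RiemannHypothesis.RiemannHypothesis.Theorems.WeilGroundStateGroundStatesConvergeToXiStubStrongClassPairing
import Summits.RiemannHypothesis.RiemannHypothesis.Theorems.WeilGroundStateGroundStatesConvergeToXiStubZeroSideTruncation
import Literature.NumberTheory.LFunctions.WeilOddThetaVector
import Mathlib.MeasureTheory.Measure.Lebesgue.Integral
import Mathlib.MeasureTheory.Integral.IntervalIntegral.Basic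
import Mathlib.Analysis.Calculus.IteratedDeriv.Lemmas
import HarnessLib

/-!
# The leakage sign lemma (crux `GroundBarta.GroundBartaFloor`, stmt-RiemannHypothesis-18389;
line `outer_cutoff_harmonic_pairing`, registered stub S `stub_leakageSign`)

For a non-negative integrable real `v` vanishing off the window `[-a, a]` and a cut-off `χ` with
`χ = 1` on `[-a, a]`, `0 ≤ χ ≤ 1`, such that the LEAKAGE KERNEL `κ = Φ(1 - χ)` (`Φ = weilThetaPhi`,
Riemann's kernel) lies in the exponential Weil class, the Weil functional of `f = v ⋆ κ̃` satisfies

  `Re W(v ⋆ κ̃) ≤ 2 (∫ v cosh(t/2)) ϖ_a`,  `ϖ_a = ∫_{s>a} Φ(s)·2cosh(s/2) ds`.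

The three terms of `W = polar − prime + arch` are ONE-SIGNED for this `f`:
* `f = v ⋆ κ̃ ≥ 0` is real, so the PRIME term `Σ Λ(n) n^{-1/2}(f(log n) + f(−log n))` is `≥ 0`;
* `f(0) = ∫ v κ = 0` (disjoint supports), so Bombieri's ARCHIMEDEAN term (equal to the digamma
  form on the class, `weilArchTermBombieri_eq_weilArchTerm_expClass`) is
  `−∫₀^∞ e^{t/2}(f(t) + f(−t))/(2 sinh t) dt ≤ 0`;
* the POLAR term is `v̂(0) conj κ̂(1) + v̂(1) conj κ̂(0)` (`stub_strongClass_pairing`) with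
  `v̂(0), v̂(1) ≥ 0` and `κ̂(0), κ̂(1) ≤ ϖ_a` (`0 ≤ κ ≤ Φ·𝟙_{|t|>a}`, fold `t ↦ −t` of the left
  half-line), whence `Re polar ≤ (v̂(0) + v̂(1)) ϖ_a = 2 (∫ v cosh(t/2)) ϖ_a`.
Elementary; no published source needed beyond Bombieri 2000 (explicit formula, Thm 2). [folklore]
-/

set_option linter.dupNamespace false

noncomputable section

open Set MeasureTheory Filter Complex
open scoped Real Topology ComplexConjugate ArithmeticFunction.vonMangoldt

namespace Summit.RiemannHypothesis.RiemannHypothesis.Theorems.GroundBartaFloor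

open Literature.NumberTheory.LFunctions
open Summit.RiemannHypothesis.RiemannHypothesis.Theorems.GroundStatesConvergeToXi

/-! ## Riemann's kernel: a crude exponential envelope -/

/-- `Φ(t) ≤ C e^{-|t|}` with `C ≥ 0` (order `0` of `stub_phi_iteratedDeriv_envelope`). [folklore] -/
theorem leakSign_phi_le_exp :
    ∃ C : ℝ, 0 ≤ C ∧ ∀ t : ℝ, weilThetaPhi t ≤ C * Real.exp (-(1 * |t|)) := by
  obtain ⟨C, hC0, hC⟩ := leakEnv_phi_envelope 0
  refine ⟨C, hC0, fun t => ?_⟩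
  have h := hC t
  rw [iteratedDeriv_zero, ← leakEnv_ofReal_weilThetaPhi, Complex.norm_real, Real.norm_eq_abs,
    abs_of_pos (weilThetaPhi_pos t)] at h
  exact h

/-! ## The one-sided polar bound `∫ g e^{±t/2} ≤ ϖ_a` for `0 ≤ g ≤ Φ 𝟙_{|t|>a}` -/

/-- Integrability of `g(t) e^{t/2}` for a continuous `0 ≤ g ≤ Φ`. [folklore] -/
theorem leakSign_integrable_mul_exp_half {g : ℝ → ℝ} (hgc : Continuous g) (hg0 : ∀ t, 0 ≤ g t)
    (hgΦ : ∀ t, g t ≤ weilThetaPhi t) :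
    Integrable fun t : ℝ => g t * Real.exp (1 / 2 * t) := by
  obtain ⟨C, -, hC⟩ := leakSign_phi_le_exp
  refine ((zsTrunc_integrable_exp_weight (b₀ := 1) (by norm_num)).const_mul C).mono'
    (hgc.mul (by fun_prop)).aestronglyMeasurable (ae_of_all _ fun t => ?_)
  rw [Real.norm_eq_abs, abs_of_nonneg (mul_nonneg (hg0 t) (Real.exp_pos _).le), ← mul_assoc]
  refine mul_le_mul ((hgΦ t).trans (hC t)) (Real.exp_le_exp.2 ?_) (Real.exp_pos _).le
    ((weilThetaPhi_pos t).le.trans (hC t))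
  have := le_abs_self t
  linarith

/-- The polar-weight integrand `Φ(s)·2cosh(s/2)` is integrable on `ℝ`. [folklore] -/
theorem leakSign_integrable_phi_mul_two_cosh :
    Integrable fun s : ℝ => weilThetaPhi s * (2 * Real.cosh (s / 2)) := by
  obtain ⟨C, -, hC⟩ := leakSign_phi_le_exp
  refine ((zsTrunc_integrable_exp_weight (b₀ := 1) (by norm_num)).const_mul (2 * C)).mono'
    (continuous_weilThetaPhi.mul (by fun_prop)).aestronglyMeasurable (ae_of_all _ fun s => ?_)
  rw [Real.norm_eq_abs, abs_of_nonneg (mul_nonneg (weilThetaPhi_pos s).le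
    (mul_nonneg zero_le_two (Real.cosh_pos _).le))]
  have hcosh : 2 * Real.cosh (s / 2) ≤ 2 * Real.exp (|s| / 2) := by
    rw [Real.cosh_eq]
    have h1 : Real.exp (s / 2) ≤ Real.exp (|s| / 2) :=
      Real.exp_le_exp.2 (by linarith [le_abs_self s])
    have h2 : Real.exp (-(s / 2)) ≤ Real.exp (|s| / 2) :=
      Real.exp_le_exp.2 (by linarith [neg_abs_le s])
    linarith
  calc weilThetaPhi s * (2 * Real.cosh (s / 2))
      ≤ (C * Real.exp (-(1 * |s|))) * (2 * Real.exp (|s| / 2)) :=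
        mul_le_mul (hC s) hcosh (mul_nonneg zero_le_two (Real.cosh_pos _).le)
          ((weilThetaPhi_pos s).le.trans (hC s))
    _ = 2 * C * (Real.exp (-(1 * |s|)) * Real.exp (|s| / 2)) := by ring

/-- **One-sided polar bound.**  If `g` is continuous with `0 ≤ g ≤ Φ` and `g = 0` on `[-a, a]`
(`a ≥ 0`), then `∫ g(t) e^{t/2} dt ≤ ϖ_a = ∫_{s>a} Φ(s)·2cosh(s/2) ds`: fold the left half-line
onto the right one (`t ↦ -t`), where `g(-t)e^{-t/2} + g(t)e^{t/2} ≤ Φ(t)·2cosh(t/2)·𝟙_{t>a}`.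
[folklore] -/
theorem leakSign_integral_mul_exp_half_le {g : ℝ → ℝ} {a : ℝ} (ha : 0 ≤ a) (hgc : Continuous g)
    (hg0 : ∀ t, 0 ≤ g t) (hgΦ : ∀ t, g t ≤ weilThetaPhi t)
    (hgz : ∀ t ∈ Icc (-a) a, g t = 0) :
    ∫ t : ℝ, g t * Real.exp (1 / 2 * t) ≤
      ∫ s in Ioi a, weilThetaPhi s * (2 * Real.cosh (s / 2)) := by
  set G : ℝ → ℝ := fun t => g t * Real.exp (1 / 2 * t) with hG
  set P : ℝ → ℝ := fun s => weilThetaPhi s * (2 * Real.cosh (s / 2)) with hP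
  have hGi : Integrable G := leakSign_integrable_mul_exp_half hgc hg0 hgΦ
  have hGn : Integrable fun t => G (-t) := hGi.comp_neg
  have hPi : Integrable P := leakSign_integrable_phi_mul_two_cosh
  -- fold the left half-line
  have hsplit : ∫ t, G t = (∫ t in Ioi (0 : ℝ), G (-t)) + ∫ t in Ioi (0 : ℝ), G t := by
    rw [← intervalIntegral.integral_Iic_add_Ioi hGi.integrableOn hGi.integrableOn,
      integral_comp_neg_Ioi 0 G, neg_zero]
  have hsum : (∫ t in Ioi (0 : ℝ), G (-t)) + ∫ t in Ioi (0 : ℝ), G t =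
      ∫ t in Ioi (0 : ℝ), (G (-t) + G t) :=
    (integral_add hGn.integrableOn hGi.integrableOn).symm
  -- pointwise comparison on `(0, ∞)` with the indicator of `(a, ∞)`
  have hle : ∀ t ∈ Ioi (0 : ℝ), G (-t) + G t ≤ (Ioi a).indicator P t := by
    intro t ht
    have ht0 : 0 < t := ht
    by_cases hta : t ∈ Ioi a
    · rw [indicator_of_mem hta, hP, hG]
      dsimp only
      have h1 : g (-t) ≤ weilThetaPhi t := by rw [← weilThetaPhi_neg t]; exact hgΦ (-t)
      have h2 : g t ≤ weilThetaPhi t := hgΦ t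
      have e1 : 0 ≤ Real.exp (1 / 2 * -t) := (Real.exp_pos _).le
      have e2 : 0 ≤ Real.exp (1 / 2 * t) := (Real.exp_pos _).le
      have hcosh : 2 * Real.cosh (t / 2) = Real.exp (1 / 2 * -t) + Real.exp (1 / 2 * t) := by
        rw [Real.cosh_eq]
        have ea : Real.exp (t / 2) = Real.exp (1 / 2 * t) := by congr 1; ring
        have eb : Real.exp (-(t / 2)) = Real.exp (1 / 2 * -t) := by congr 1; ring
        rw [ea, eb]; ring
      rw [hcosh, mul_add]
      exact add_le_add (mul_le_mul_of_nonneg_right h1 e1) (mul_le_mul_of_nonneg_right h2 e2)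
    · rw [indicator_of_notMem hta, hG]
      dsimp only
      have hta' : t ≤ a := not_lt.1 hta
      have hz1 : g t = 0 := hgz t ⟨by linarith, hta'⟩
      have hz2 : g (-t) = 0 := hgz (-t) ⟨by linarith, by linarith⟩
      rw [hz1, hz2]; simp
  have hInd : IntegrableOn (fun t => (Ioi a).indicator P t) (Ioi 0) :=
    (hPi.indicator measurableSet_Ioi).integrableOn
  calc ∫ t, G t = ∫ t in Ioi (0 : ℝ), (G (-t) + G t) := by rw [hsplit, hsum]
    _ ≤ ∫ t in Ioi (0 : ℝ), (Ioi a).indicator P t :=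
        setIntegral_mono_on (hGn.integrableOn.add hGi.integrableOn) hInd measurableSet_Ioi hle
    _ = ∫ t in Ioi (0 : ℝ) ∩ Ioi a, P t := setIntegral_indicator measurableSet_Ioi
    _ = ∫ s in Ioi a, P s := by rw [Ioi_inter_Ioi, max_eq_right ha]

/-- The mirror bound `∫ g(t) e^{-t/2} dt ≤ ϖ_a` (apply the previous one to `g(-·)`, `Φ` even).
[folklore] -/
theorem leakSign_integral_mul_exp_neg_half_le {g : ℝ → ℝ} {a : ℝ} (ha : 0 ≤ a)
    (hgc : Continuous g) (hg0 : ∀ t, 0 ≤ g t) (hgΦ : ∀ t, g t ≤ weilThetaPhi t)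
    (hgz : ∀ t ∈ Icc (-a) a, g t = 0) :
    ∫ t : ℝ, g t * Real.exp (-(1 / 2) * t) ≤
      ∫ s in Ioi a, weilThetaPhi s * (2 * Real.cosh (s / 2)) := by
  have h := leakSign_integral_mul_exp_half_le (g := fun t => g (-t)) ha (hgc.comp continuous_neg)
    (fun t => hg0 _) (fun t => by rw [← weilThetaPhi_neg t]; exact hgΦ (-t))
    (fun t ht => hgz (-t) ⟨by linarith [ht.2], by linarith [ht.1]⟩)
  have e : ∫ t : ℝ, g t * Real.exp (-(1 / 2) * t) = ∫ t : ℝ, g (-t) * Real.exp (1 / 2 * t) := by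
    rw [← integral_neg_eq_self (fun t : ℝ => g (-t) * Real.exp (1 / 2 * t))]
    refine integral_congr_ae (ae_of_all _ fun t => ?_)
    simp only [neg_neg]
    congr 1; congr 1; ring
  rw [e]
  exact h

/-! ## Transforms of real functions at `s = 0, 1` -/

/-- For a real `w`, `ŵ(s) = ∫ w(t) e^{ct} dt` as a real integral whenever `s - 1/2 = c` is real.
[folklore] -/
theorem leakSign_weilMellin_ofReal (w : ℝ → ℝ) {s : ℂ} {c : ℝ} (hc : s - 1 / 2 = (c : ℂ)) :
    weilMellin (fun t => ((w t : ℝ) : ℂ)) s = ((∫ t, w t * Real.exp (c * t) : ℝ) : ℂ) := by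
  unfold weilMellin
  rw [hc, ← integral_complex_ofReal]
  refine integral_congr_ae (ae_of_all _ fun t => ?_)
  simp only [Complex.ofReal_mul, Complex.ofReal_exp]

/-! ## The leakage function `f = v ⋆ κ̃` -/

section Leak

variable {a : ℝ} {v χ : ℝ → ℝ}

/-- `0 ≤ Φ(1 - χ)` for `χ ≤ 1`. [folklore] -/
theorem leakKer_nonneg (hχ01 : ∀ t, 0 ≤ χ t ∧ χ t ≤ 1) (t : ℝ) :
    0 ≤ weilThetaPhi t * (1 - χ t) :=
  mul_nonneg (weilThetaPhi_pos t).le (by linarith [(hχ01 t).2])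

/-- `Φ(1 - χ) ≤ Φ` for `0 ≤ χ`. [folklore] -/
theorem leakKer_le (hχ01 : ∀ t, 0 ≤ χ t ∧ χ t ≤ 1) (t : ℝ) :
    weilThetaPhi t * (1 - χ t) ≤ weilThetaPhi t :=
  mul_le_of_le_one_right (weilThetaPhi_pos t).le (by linarith [(hχ01 t).1])

/-- `Φ(1 - χ) = 0` on the window, where `χ = 1`. [folklore] -/
theorem leakKer_eq_zero (hχ1 : ∀ t ∈ Icc (-a) a, χ t = 1) {t : ℝ} (ht : t ∈ Icc (-a) a) :
    weilThetaPhi t * (1 - χ t) = 0 := by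
  simp [hχ1 t ht]

/-- Continuity of `κ_r`, read off the smoothness of its complex spelling. [folklore] -/
theorem continuous_leakKer
    (hκd : ContDiff ℝ (⊤ : ℕ∞) (fun t : ℝ => ((weilThetaPhi t * (1 - χ t) : ℝ) : ℂ))) :
    Continuous fun t : ℝ => weilThetaPhi t * (1 - χ t) := by
  have h := Complex.continuous_re.comp hκd.continuous
  have e : (Complex.re ∘ fun t : ℝ => ((weilThetaPhi t * (1 - χ t) : ℝ) : ℂ)) =
      fun t : ℝ => weilThetaPhi t * (1 - χ t) := by
    funext t; simp
  rwa [e] at h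

/-- `κ̃ = κ_r(-·)` for the real kernel. [folklore] -/
theorem weilReflect_leakKer (χ : ℝ → ℝ) (x : ℝ) :
    weilReflect (fun t : ℝ => ((weilThetaPhi t * (1 - χ t) : ℝ) : ℂ)) x =
      ((weilThetaPhi (-x) * (1 - χ (-x)) : ℝ) : ℂ) := by
  simp [weilReflect]

/-- `v ⋆ κ̃` is the complexification of the real leakage function `F`. [folklore] -/
theorem weilConv_leak_eq (v χ : ℝ → ℝ) (t : ℝ) :
    weilConv (fun t => ((v t : ℝ) : ℂ))
        (weilReflect fun t : ℝ => ((weilThetaPhi t * (1 - χ t) : ℝ) : ℂ)) t =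
      ((∫ u, v u * (weilThetaPhi (-(t - u)) * (1 - χ (-(t - u)))) : ℝ) : ℂ) := by
  rw [weilConv_apply, ← integral_complex_ofReal]
  refine integral_congr_ae (ae_of_all _ fun u => ?_)
  dsimp only
  rw [weilReflect_leakKer]
  push_cast
  ring

/-- The real leakage function `∫ v(u) κ_r(-(t-u)) du` is non-negative. [folklore] -/
theorem leakFun_nonneg (hv0 : ∀ t, 0 ≤ v t) (hχ01 : ∀ t, 0 ≤ χ t ∧ χ t ≤ 1) (t : ℝ) :
    0 ≤ ∫ u, v u * (weilThetaPhi (-(t - u)) * (1 - χ (-(t - u)))) :=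
  integral_nonneg fun u => mul_nonneg (hv0 u) (leakKer_nonneg hχ01 _)

/-- `F(0) = ∫ v κ_r = 0`: `v` lives on `[-a, a]`, where `κ_r` vanishes. [folklore] -/
theorem leakFun_zero (hvs : ∀ t, t ∉ Icc (-a) a → v t = 0)
    (hχ1 : ∀ t ∈ Icc (-a) a, χ t = 1) :
    ∫ u, v u * (weilThetaPhi (-(0 - u)) * (1 - χ (-(0 - u)))) = 0 := by
  have h : (fun u => v u * (weilThetaPhi (-(0 - u)) * (1 - χ (-(0 - u))))) = fun _ => 0 := by
    funext u
    rw [zero_sub, neg_neg]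
    by_cases hu : u ∈ Icc (-a) a
    · rw [leakKer_eq_zero hχ1 hu, mul_zero]
    · rw [hvs u hu, zero_mul]
  rw [h, integral_zero]

end Leak

/-! ## The stub -/

/-- **Stub S — the leakage sign lemma.**  For a non-negative integrable real `v` vanishing off
`[-a, a]` and a cut-off `χ` with `χ = 1` on `[-a, a]`, `0 ≤ χ ≤ 1`, `χ` even, and the leakage kernel
`κ = Φ(1 - χ)` in the exponential class: `Re W(v ⋆ κ̃) ≤ 2 (∫ v cosh(t/2)) ϖ_a`,
`ϖ_a = ∫_{s>a} Φ(s) 2cosh(s/2) ds` — `f = v ⋆ κ̃ ≥ 0`, `f(0) = 0`, prime term `≥ 0`, Bombieri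
archimedean term `≤ 0` (`weilArchTermBombieri_eq_weilArchTerm_expClass`), polar term
`v̂(0) conj κ̂(1) + v̂(1) conj κ̂(0)` with `κ̂(0), κ̂(1) ≤ ϖ_a`. [folklore] -/
theorem stub_leakageSign :
    ∀ (a : ℝ) (v : ℝ → ℝ) (χ : ℝ → ℝ), 0 < a → Integrable v → (∀ t, 0 ≤ v t) →
      (∀ t, t ∉ Icc (-a) a → v t = 0) →
      (∀ t ∈ Icc (-a) a, χ t = 1) → (∀ t, 0 ≤ χ t ∧ χ t ≤ 1) → (∀ t, χ (-t) = χ t) →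
      ContDiff ℝ (⊤ : ℕ∞) (fun t : ℝ => ((weilThetaPhi t * (1 - χ t) : ℝ) : ℂ)) →
      (∀ k : ℕ, ∃ C : ℝ, ∀ t : ℝ,
        ‖iteratedDeriv k (fun t : ℝ => ((weilThetaPhi t * (1 - χ t) : ℝ) : ℂ)) t‖ ≤
          C * Real.exp (-(1 * |t|))) →
      (weilFunctional (weilConv (fun t => ((v t : ℝ) : ℂ))
          (weilReflect fun t => ((weilThetaPhi t * (1 - χ t) : ℝ) : ℂ)))).re ≤
        2 * (∫ t, v t * Real.cosh (t / 2)) *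
          ∫ s in Ioi a, weilThetaPhi s * (2 * Real.cosh (s / 2)) := by
  intro a v χ ha hvi hv0 hvs hχ1 hχ01 _hχe hκd hκb
  -- notation
  set vc : ℝ → ℂ := fun t => ((v t : ℝ) : ℂ) with hvc
  set κ : ℝ → ℂ := fun t : ℝ => ((weilThetaPhi t * (1 - χ t) : ℝ) : ℂ) with hκ
  set f : ℝ → ℂ := weilConv vc (weilReflect κ) with hf
  set ϖ : ℝ := ∫ s in Ioi a, weilThetaPhi s * (2 * Real.cosh (s / 2)) with hϖ
  set κr : ℝ → ℝ := fun t => weilThetaPhi t * (1 - χ t) with hκrdef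
  set F : ℝ → ℝ := fun t => ∫ u, v u * (weilThetaPhi (-(t - u)) * (1 - χ (-(t - u)))) with hFdef
  have hκr : Continuous κr := continuous_leakKer hκd
  have hϖ0 : 0 ≤ ϖ := setIntegral_nonneg measurableSet_Ioi fun s _ =>
    mul_nonneg (weilThetaPhi_pos s).le (mul_nonneg zero_le_two (Real.cosh_pos _).le)
  -- `f` is the complexified real leakage function
  have hfF : ∀ t, f t = ((F t : ℝ) : ℂ) := fun t => weilConv_leak_eq v χ t
  have hF0 : ∀ t, 0 ≤ F t := leakFun_nonneg hv0 hχ01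
  have hf0 : f 0 = 0 := by
    rw [hfF, hFdef]
    dsimp only
    rw [leakFun_zero hvs hχ1, Complex.ofReal_zero]
  -- weighted-`L¹` data of `v`
  have hva : AEStronglyMeasurable vc volume := hvi.ofReal.aestronglyMeasurable
  have hvw : ∀ b : ℝ, Integrable (fun t : ℝ => ‖vc t‖ * Real.exp (b * |t|)) := by
    intro b
    refine (hvi.norm.mul_const (Real.exp (|b| * a))).mono' (hva.norm.mul (by fun_prop))
      (ae_of_all _ fun t => ?_)
    rw [Real.norm_eq_abs, abs_of_nonneg (by positivity), hvc]
    dsimp only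
    rw [Complex.norm_real]
    by_cases ht : t ∈ Icc (-a) a
    · refine mul_le_mul_of_nonneg_left (Real.exp_le_exp.2 ?_) (norm_nonneg _)
      have h1 : |t| ≤ a := abs_le.2 ⟨ht.1, ht.2⟩
      calc b * |t| ≤ |b| * |t| := mul_le_mul_of_nonneg_right (le_abs_self b) (abs_nonneg t)
        _ ≤ |b| * a := mul_le_mul_of_nonneg_left h1 (abs_nonneg b)
    · rw [hvs t ht]; simp
  -- the class data of `f`
  obtain ⟨hfcd, hfb, hmel⟩ := stub_strongClass_pairing vc κ 1 1 hva (by norm_num) (hvw 1) hκd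
    (by norm_num) le_rfl hκb
  obtain ⟨Cf, hf0', hf1', hf2'⟩ := hExt_deriv_bounds_of_all hfb
  -- (1) the polar term
  have hM0 : weilMellin f 0 = weilMellin vc 0 * conj (weilMellin κ 1) := by
    have h := hmel 0 (by simp) (by simp)
    simpa using h
  have hM1 : weilMellin f 1 = weilMellin vc 1 * conj (weilMellin κ 0) := by
    have h := hmel 1 (by simp) (by simp)
    simpa using h
  have hv0M : weilMellin vc 0 = ((∫ t, v t * Real.exp (-(1 / 2) * t) : ℝ) : ℂ) :=
    leakSign_weilMellin_ofReal v (by push_cast; ring)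
  have hv1M : weilMellin vc 1 = ((∫ t, v t * Real.exp (1 / 2 * t) : ℝ) : ℂ) :=
    leakSign_weilMellin_ofReal v (by push_cast; ring)
  have hκ0M : weilMellin κ 0 = ((∫ t, κr t * Real.exp (-(1 / 2) * t) : ℝ) : ℂ) :=
    leakSign_weilMellin_ofReal κr (by push_cast; ring)
  have hκ1M : weilMellin κ 1 = ((∫ t, κr t * Real.exp (1 / 2 * t) : ℝ) : ℂ) :=
    leakSign_weilMellin_ofReal κr (by push_cast; ring)
  set A₀ : ℝ := ∫ t, v t * Real.exp (-(1 / 2) * t) with hA₀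
  set A₁ : ℝ := ∫ t, v t * Real.exp (1 / 2 * t) with hA₁
  set K₀ : ℝ := ∫ t, κr t * Real.exp (-(1 / 2) * t) with hK₀
  set K₁ : ℝ := ∫ t, κr t * Real.exp (1 / 2 * t) with hK₁
  have hA₀0 : 0 ≤ A₀ := integral_nonneg fun t => mul_nonneg (hv0 t) (Real.exp_pos _).le
  have hA₁0 : 0 ≤ A₁ := integral_nonneg fun t => mul_nonneg (hv0 t) (Real.exp_pos _).le
  have hK₀le : K₀ ≤ ϖ := leakSign_integral_mul_exp_neg_half_le ha.le hκr (leakKer_nonneg hχ01)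
    (leakKer_le hχ01) (fun t ht => leakKer_eq_zero hχ1 ht)
  have hK₁le : K₁ ≤ ϖ := leakSign_integral_mul_exp_half_le ha.le hκr (leakKer_nonneg hχ01)
    (leakKer_le hχ01) (fun t ht => leakKer_eq_zero hχ1 ht)
  have hpolar : (weilPolarTerm f).re = A₀ * K₁ + A₁ * K₀ := by
    rw [weilPolarTerm, hM0, hM1, hv0M, hv1M, hκ0M, hκ1M, Complex.conj_ofReal, Complex.conj_ofReal]
    simp only [Complex.add_re, Complex.mul_re, Complex.ofReal_re, Complex.ofReal_im, mul_zero,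
      sub_zero]
  -- `A₀ + A₁ = 2 ∫ v cosh(t/2)`
  have hvint : ∀ c : ℝ, Integrable fun t => v t * Real.exp (c * t) := by
    intro c
    refine (hvw |c|).mono' (hvi.aestronglyMeasurable.mul (by fun_prop)) (ae_of_all _ fun t => ?_)
    rw [Real.norm_eq_abs, abs_mul, abs_of_pos (Real.exp_pos _), hvc]
    dsimp only
    rw [Complex.norm_real, Real.norm_eq_abs]
    refine mul_le_mul_of_nonneg_left (Real.exp_le_exp.2 ?_) (abs_nonneg _)
    calc c * t ≤ |c * t| := le_abs_self _
      _ = |c| * |t| := abs_mul c t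
  have hsum : A₀ + A₁ = 2 * ∫ t, v t * Real.cosh (t / 2) := by
    rw [hA₀, hA₁, ← integral_add (hvint _) (hvint _), ← integral_const_mul]
    refine integral_congr_ae (ae_of_all _ fun t => ?_)
    have e1 : Real.exp (-(1 / 2) * t) = Real.exp (-(t / 2)) := by congr 1; ring
    have e2 : Real.exp (1 / 2 * t) = Real.exp (t / 2) := by congr 1; ring
    simp only [e1, e2, Real.cosh_eq]
    ring
  have hpolar_le : (weilPolarTerm f).re ≤ 2 * (∫ t, v t * Real.cosh (t / 2)) * ϖ := by
    rw [hpolar, ← hsum, add_mul]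
    exact add_le_add (mul_le_mul_of_nonneg_left hK₁le hA₀0) (mul_le_mul_of_nonneg_left hK₀le hA₁0)
  -- (2) the prime term is non-negative
  have hprime : 0 ≤ (weilPrimeTerm f).re := by
    have e : weilPrimeTerm f = ((∑' n : ℕ, ((Λ n : ℝ) / Real.sqrt n *
        (F (Real.log n) + F (-Real.log n))) : ℝ) : ℂ) := by
      rw [weilPrimeTerm, Complex.ofReal_tsum]
      refine tsum_congr fun n => ?_
      rw [hfF, hfF]
      push_cast
      ring
    rw [e, Complex.ofReal_re]
    exact tsum_nonneg fun n => mul_nonneg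
      (div_nonneg ArithmeticFunction.vonMangoldt_nonneg (Real.sqrt_nonneg _))
      (add_nonneg (hF0 _) (hF0 _))
  -- (3) the archimedean term is non-positive (Bombieri's form, `f(0) = 0`)
  have harch : (weilArchTerm f).re ≤ 0 := by
    rw [← weilArchTermBombieri_eq_weilArchTerm_expClass hfcd (by norm_num : (1 : ℝ) / 2 < 1)
      hf0' hf1' hf2', weilArchTermBombieri, ← hf, hf0]
    have e : ∫ t in Ioi (0 : ℝ), ((Real.exp (t / 2) : ℂ) * (f t + f (-t)) - 2 * (0 : ℂ)) /
        (2 * Real.sinh t : ℂ) =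
        ((∫ t in Ioi (0 : ℝ), Real.exp (t / 2) * (F t + F (-t)) /
          (2 * Real.sinh t) : ℝ) : ℂ) := by
      rw [← integral_complex_ofReal]
      refine integral_congr_ae (ae_of_all _ fun t => ?_)
      dsimp only
      rw [hfF, hfF]
      push_cast
      ring
    rw [e]
    simp only [mul_zero, zero_add, Complex.neg_re, Complex.ofReal_re, neg_nonpos]
    exact setIntegral_nonneg measurableSet_Ioi fun t ht => div_nonneg
      (mul_nonneg (Real.exp_pos _).le (add_nonneg (hF0 _) (hF0 _)))
      (mul_nonneg zero_le_two (Real.sinh_nonneg_iff.2 (le_of_lt ht)))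
  -- (4) assemble
  have hW : (weilFunctional f).re = (weilPolarTerm f).re - (weilPrimeTerm f).re +
      (weilArchTerm f).re := by
    rw [weilFunctional, Complex.add_re, Complex.sub_re]
  rw [hW]
  linarith

end Summit.RiemannHypothesis.RiemannHypothesis.Theorems.GroundBartaFloor

end
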